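import Literature.IUT.HodgeArakelov.EtaleThetaDataCoeffChange
import Literature.AnabelianGeometry.EtaleTheta.ContH1OddTorsionTransport

/-!
# The §2 transport at the model `Π := Π^tp_X̲̲`: the signs `hsign` / non-torsion `hfree` of the `l`-th root class
# `η̲̈^Θ` from the `Δ_Θ`-level statements about `η̈^Θ` ([EtTh] Prop. 1.4 (ii) / (i),(iii) at the class level)

Mochizuki, *The étale theta function …*, Publ. RIMS **45** (2009): Prop. 1.4 (ii) p. 20 ("`Θ̈(−Ü) = −Θ̈(Ü)`"),
Def. 2.7 p. 41 ("the class `η̈^Θ` determines a class `η̲̈^Θ ∈ H¹(Π^tp_Ÿ̲̲, l·Δ_Θ)` … [an] `l`-th root … up to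
multiplication by a root of unity of order `l`", "`Π^tp_X̲̲/Π^tp_Ÿ̲̲ ≅ (l·ℤ) × μ₂`") [cite: MochizukiEtTh2009, Def 2.7 p.41];
consumer: [IUTchII] Prop. 2.2 (ii) at the model, `Literature.IUT.HodgeArakelov.prop22_ii'_model`
(`ThetaEvaluationSettingModelAssembly.lean`, abc-iut-w4-d010), binders (R2) `hsign` and (R3) `hfree`
[cite: Mochizuki2012, Prop 2.2 (ii) p.66].

PROOF-ONLY companion (no definitions; cell abc-iut, seat abc-iut-L2-t8 — owner of the `X̲̲` layer
`DoubleUnderline.lean` / `ThetaCyclotomes.lean`; GAP row G-w4d010-2, "§2 transport"). For abc-iut-L6-t1's model data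
`C : E.DoubleUnderline l` (`Π^tp_X̲̲ = C.Huu`, `Π_Ÿ(Π) = PiYdd C`, root class `rootLiftClass C ∈ H¹(Π_Ÿ(Π), l·Δ_Θ)`) and
`ε ∈ Π^tp_X̲̲` with `ε ∈ Π^tp_Y ∖ Π^tp_Ÿ`:

* `conj_sq_eq_self` — `ε² ∈ Π^tp_Ÿ̲̲` (`[Π^tp_Y̲̲ : Π^tp_Ÿ̲̲] = 2`, `relIndex_GtpYdd_inf`), so `conj ε` is an involution on
  `H¹(Π_Ÿ(Π), ·)`;
* `conj_eq_self_of_coeffChange_eq_one` — `conj ε` fixes `Ker(H¹(Π_Ÿ(Π), l·Δ_Θ) → H¹(Π_Ÿ(Π), Δ_Θ))` pointwise: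
  the GEOMETRIC representative `ε·y` (`y ∈ Π^tp_Ÿ̲̲`, which surjects onto `G_K`: `map_aug_Ydduu`) acts like `ε`
  and centralises `Δ_Θ` (`Δ_Θ` is central in `(Δ^tp_X)^Θ`, §1 p. 12: `ker_thetaToEll_central`);
* `coeffChange_rootLiftClass_eq_comap`, `conj_coeffChange_rootLiftClass` — under the change of coefficients the
  root class is the pull-back of `η̈^Θ` (abc-iut-w4-d014's `coeffChange_rootLiftClass_eq_comap_etaDd`), compatibly
  with conjugation;
* **`hsign_of_coeffChange_sign`**, **`hsign_of_etaDd_sign`** — (R2): `∃ κ, κ² = 1 ∧ ε·η̲̈^Θ = η̲̈^Θ·κ` FOLLOWS from the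
  `Δ_Θ`-level sign `ε·η̈^Θ = η̈^Θ·κ₁`, `κ₁² = 1` (on `H¹(Π^tp_Ÿ, Δ_Θ)`; [EtTh] Prop. 1.4 (ii) at the class level, the
  form (P14ii-cl) of plan/L2/SUBDAG-EtTh-Prop14.md L09) and NOTHING ELSE — by
  `ContH1.exists_sq_eq_one_of_conj_coeffChange_eq` (`l` odd): no `μ_l ⊆ K`, no `l·Δ_Θ`-valued Kummer class of `−1`;
* **`not_isOfFinOrder_translate_of_etaDd`**, **`hfree_of_etaDd_free`** — (R3): "`(γᵏ·η̲̈^Θ)·(η̲̈^Θ)⁻¹` is not torsion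
  for `k ≠ 0`" FOLLOWS from the same statement for the pull-back of `η̈^Θ` with `Δ_Θ`-coefficients (torsion is
  reflected by the change of coefficients, `isOfFinOrder_coeffChange_iff`).

Honest framing: the `Δ_Θ`-level inputs remain HYPOTHESES here (owners abc-iut-L2-t1, abc-iut-L2-t12: `etaDd` is abstract data
until `etaDd := kummerTheta`); [EtTh] is refereed; the consumer's claim key `Mochizuki2012` is disputed (D-0012);
nothing here bears on [IUTchIII] Cor. 3.12. typed ≠ proved.
-/

namespace Literature.IUT.HodgeArakelov

open Literature.AnabelianGeometry.EtaleTheta (ContH1 contCocycles)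
open Literature.AnabelianGeometry.EtaleTheta
open EtaleThetaDataOfSetting

noncomputable section

namespace EtaleThetaDataOfSetting

variable {p : ℕ} [Fact p.Prime] {D : Literature.AnabelianGeometry.EtaleTheta.ThetaSetting p}
  {E : D.EtaleThetaData} {l : ℕ} (C : E.DoubleUnderline l) [hN : (PiYdd C).Normal]

/-! ### `ε² ∈ Π^tp_Ÿ̲̲`: `conj ε` is an involution on `H¹(Π_Ÿ(Π), ·)` -/

omit hN in
/-- For `ε ∈ Π^tp_X̲̲ ∩ Π^tp_Y = Π^tp_Y̲̲`: `ε² ∈ Π_Ÿ(Π) = Π^tp_Ÿ̲̲` ("`Π^tp_X̲̲/Π^tp_Ÿ̲̲ ≅ (l·ℤ) × μ₂`", p. 41: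
`[Π^tp_Y̲̲ : Π^tp_Ÿ̲̲] = 2`, abc-iut-L2-t8 `relIndex_GtpYdd_inf`). [cite: MochizukiEtTh2009, Def 2.7 p.41] -/
theorem mul_self_mem_piYdd (hS : D.Sec2Hyps) (ε : Pi C) (hε₁ : (ε : D.PiTemp) ∈ D.GtpY) :
    ε * ε ∈ PiYdd C ⊓ ⊤ := by
  have h2 : (D.GtpYdd.subgroupOf (C.Huu ⊓ D.GtpY)).index = 2 := C.relIndex_GtpYdd_inf hS
  let aε : ↥(C.Huu ⊓ D.GtpY) := ⟨(ε : D.PiTemp), Subgroup.mem_inf.mpr ⟨ε.2, hε₁⟩⟩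
  have hsq : aε * aε ∈ D.GtpYdd.subgroupOf (C.Huu ⊓ D.GtpY) := Subgroup.mul_self_mem_of_index_two h2 aε
  rw [Subgroup.mem_subgroupOf] at hsq
  exact Subgroup.mem_inf.mpr
    ⟨Subgroup.mem_subgroupOf.mpr (Subgroup.mem_inf.mpr ⟨hsq, (ε * ε).2⟩), Subgroup.mem_top _⟩

/-- Hence `conj ε ∘ conj ε = id` on `H¹(Π_Ÿ(Π), A)` for any coefficients `A` (inner automorphisms act trivially,
abc-iut-L2-t1 `ContH1.conj_eq_self_of_mem`). [cite: MochizukiEtTh2009, Def 2.7 p.41] -/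
theorem conj_conj_eq_self (hS : D.Sec2Hyps) {A : Subgroup D.GtpTheta} [A.Normal] [IsMulCommutative A]
    (ε : Pi C) (hε₁ : (ε : D.PiTemp) ∈ D.GtpY) (x : ContH1 (phi C) A (PiYdd C ⊓ ⊤)) :
    ContH1.conj (phi C) A ε (ContH1.conj (phi C) A ε x) = x := by
  rw [← ContH1.conj_mul_apply]
  exact ContH1.conj_eq_self_of_mem _ (mul_self_mem_piYdd C hS ε hε₁) x

/-! ### The geometric representative: `conj ε` fixes the `μ_l`-ambiguity -/

omit hN in
/-- Every `ε ∈ Π^tp_X̲̲` has a GEOMETRIC representative modulo `Π_Ÿ(Π)`: some `y ∈ Π^tp_Ÿ̲̲` with `ε·y ∈ Δ^tp_X`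
(`Π^tp_Ÿ̲̲ ↠ G_K`: "`G_K ≅ Π_X̲̲/Δ_X̲̲`", Prop. 2.2 (iii) p. 37 — abc-iut-L2-t8's field `map_aug_Ydduu`).
[cite: MochizukiEtTh2009, Prop 2.2 (iii) p.37] -/
theorem exists_mul_mem_piYdd_aug_eq_one (ε : Pi C) :
    ∃ y : Pi C, y ∈ PiYdd C ⊓ ⊤ ∧ D.aug.toMonoidHom (((ε * y : Pi C) : D.PiTemp)) = 1 := by
  have hmem : (D.aug.toMonoidHom (ε : D.PiTemp))⁻¹ ∈ (D.GtpYdd ⊓ C.Huu).map D.aug.toMonoidHom := by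
    rw [C.map_aug_Ydduu]
    exact inv_mem (D.aug_mem_GK _)
  obtain ⟨z, hz, hzeq⟩ := hmem
  refine ⟨⟨z, (Subgroup.mem_inf.mp hz).2⟩, Subgroup.mem_inf.mpr ⟨Subgroup.mem_subgroupOf.mpr hz,
    Subgroup.mem_top _⟩, ?_⟩
  change D.aug.toMonoidHom ((ε : D.PiTemp) * z) = 1
  rw [map_mul, hzeq, mul_inv_cancel]

omit hN in
/-- A geometric element of `Π^tp_X̲̲` CENTRALISES `Δ_Θ` through `φ : Π^tp_X̲̲ → (Π^tp_X)^Θ` ("`Δ_Θ` … central in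
`(Δ^tp_X)^Θ`", §1 p. 12 — the root field `ker_thetaToEll_central`). [cite: MochizukiEtTh2009, §1 p.12] -/
theorem commute_phi_of_aug_eq_one (g : Pi C) (hg : D.aug.toMonoidHom ((g : D.PiTemp)) = 1)
    (a : D.DeltaTheta) : Commute (phi C g) (a : D.GtpTheta) := by
  have hmem : phi C g ∈ (D.aug.toMonoidHom.ker).map D.toTheta :=
    ⟨(g : D.PiTemp), (MonoidHom.mem_ker).mpr hg, rfl⟩
  exact (D.ker_thetaToEll_central a a.2 (phi C g) hmem).symm

/-- **`conj ε` fixes `Ker(H¹(Π_Ÿ(Π), l·Δ_Θ) → H¹(Π_Ÿ(Π), Δ_Θ))` pointwise**, for EVERY `ε ∈ Π^tp_X̲̲`: replace `ε` by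
its geometric representative `ε·y` (`y ∈ Π_Ÿ(Π)` acts trivially on `H¹(Π_Ÿ(Π), ·)`), which centralises `Δ_Θ`, and
apply `ContH1.conj_eq_self_of_coeffChange_eq_one`. (The kernel is the `μ_l`-ambiguity "up to multiplication by a
root of unity of order `l`" of the `l`-th root, Def. 2.7 p. 41.) [cite: MochizukiEtTh2009, Def 2.7 p.41] -/
theorem conj_eq_self_of_coeffChange_eq_one (ε : Pi C)
    (x : ContH1 (phi C) (D.lDeltaTheta l) (PiYdd C ⊓ ⊤))
    (hx : ContH1.coeffChange (phi C) (D.lDeltaTheta_le l) (PiYdd C ⊓ ⊤) x = 1) :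
    ContH1.conj (phi C) (D.lDeltaTheta l) ε x = x := by
  obtain ⟨y, hy, hεy⟩ := exists_mul_mem_piYdd_aug_eq_one C ε
  conv_lhs => rw [← ContH1.conj_eq_self_of_mem y hy x, ← ContH1.conj_mul_apply]
  exact ContH1.conj_eq_self_of_coeffChange_eq_one (phi C) (D.lDeltaTheta_le l) (PiYdd C ⊓ ⊤) (ε * y)
    (commute_phi_of_aug_eq_one C (ε * y) hεy) x hx

/-! ### The root class under change of coefficients, compatibly with conjugation -/

omit hN in
/-- `Π_Ÿ(Π) ∩ J ⊆ Π^tp_X̲̲` maps into `Π^tp_Ÿ ⊆ Π^tp_X` under `Π^tp_X̲̲ ↪ Π^tp_X`. [cite: MochizukiEtTh2009, Def 2.7 p.41] -/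
theorem map_subtype_piYdd_inf_le_GtpYdd (J : Subgroup (Pi C)) : (PiYdd C ⊓ J).map C.Huu.subtype ≤ D.GtpYdd :=
  (map_subtype_piYdd_inf_le C J).trans inf_le_left

omit hN in
/-- **The root class IS the pull-back of `η̈^Θ`** under `H¹(Π_Ÿ(Π), l·Δ_Θ) → H¹(Π_Ÿ(Π), Δ_Θ)`: pull-back along
`Π^tp_X̲̲ ↪ Π^tp_X` straight from `H¹(Π^tp_Ÿ, Δ_Θ)` (abc-iut-w4-d014's `coeffChange_rootLiftClass_eq_comap_etaDd`
pulls back the restriction to `Π^tp_Ÿ̲̲`; the two pull-backs agree definitionally). [cite: MochizukiEtTh2009, Def 2.7 p.41] -/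
theorem coeffChange_rootLiftClass_eq_comap :
    ContH1.coeffChange (phi C) (D.lDeltaTheta_le l) (PiYdd C ⊓ ⊤) (rootLiftClass C) =
      ContH1.comap D.toTheta D.DeltaTheta C.Huu.subtype continuous_subtype_val
        (map_subtype_piYdd_inf_le_GtpYdd C ⊤) E.etaDd := by
  rw [coeffChange_rootLiftClass_eq_comap_etaDd]
  induction E.etaDd using QuotientGroup.induction_on with
  | H f => rfl

/-- **Conjugation by `σ ∈ Π^tp_X̲̲` on the `Δ_Θ`-image of the root class is the pull-back of conjugation by `σ` on
`η̈^Θ ∈ H¹(Π^tp_Ÿ, Δ_Θ)`** (`Π^tp_Ÿ ⊴ Π^tp_X`; abc-iut-w4-d014's `ContH1.comap_conj`).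
[cite: MochizukiEtTh2009, Def 2.7 p.41] -/
theorem conj_coeffChange_rootLiftClass [hYN : D.GtpYdd.Normal] (σ : Pi C) :
    ContH1.conj (phi C) D.DeltaTheta σ
        (ContH1.coeffChange (phi C) (D.lDeltaTheta_le l) (PiYdd C ⊓ ⊤) (rootLiftClass C)) =
      ContH1.comap D.toTheta D.DeltaTheta C.Huu.subtype continuous_subtype_val
        (map_subtype_piYdd_inf_le_GtpYdd C ⊤) (ContH1.conj D.toTheta D.DeltaTheta (σ : D.PiTemp) E.etaDd) := by
  rw [coeffChange_rootLiftClass_eq_comap]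
  exact (ContH1.comap_conj D.toTheta D.DeltaTheta C.Huu.subtype continuous_subtype_val
    (map_subtype_piYdd_inf_le_GtpYdd C ⊤) σ E.etaDd).symm

/-- The same for a power `σᵏ` (the `γᵏ`-translates of the root class). [cite: MochizukiEtTh2009, Def 2.7 p.41] -/
theorem conj_zpow_coeffChange_rootLiftClass [hYN : D.GtpYdd.Normal] (σ : Pi C) (k : ℤ) :
    ContH1.conj (phi C) D.DeltaTheta (σ ^ k)
        (ContH1.coeffChange (phi C) (D.lDeltaTheta_le l) (PiYdd C ⊓ ⊤) (rootLiftClass C)) =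
      ContH1.comap D.toTheta D.DeltaTheta C.Huu.subtype continuous_subtype_val
        (map_subtype_piYdd_inf_le_GtpYdd C ⊤)
        (ContH1.conj D.toTheta D.DeltaTheta ((σ : D.PiTemp) ^ k) E.etaDd) := by
  rw [conj_coeffChange_rootLiftClass, SubgroupClass.coe_zpow]

/-! ### (R2) `hsign` from the `Δ_Θ`-level sign -/

/-- **`hsign` from the `Δ_Θ`-level sign of `ε` on the image of the root class.** For `l` odd (`C.l_odd`),
`ε ∈ Π^tp_X̲̲ ∩ Π^tp_Y`: if `ε` moves the `Δ_Θ`-image of `η̲̈^Θ` by a class `κ₀` with `κ₀² = 1`, then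
`ε·η̲̈^Θ = η̲̈^Θ·κ` for a class `κ ∈ H¹(Π_Ÿ(Π), l·Δ_Θ)` with `κ² = 1` (lifting `κ₀`) — the shape of binder `hsign` of
`prop22_ii'_model`. Transport lemma `ContH1.exists_sq_eq_one_of_conj_coeffChange_eq` with
`conj_conj_eq_self` (`ε² ∈ Π^tp_Ÿ̲̲`) and `conj_eq_self_of_coeffChange_eq_one` (geometric representative).
[cite: MochizukiEtTh2009, Def 2.7 p.41] -/
theorem hsign_of_coeffChange_sign (hS : D.Sec2Hyps) (ε : Pi C) (hε₁ : (ε : D.PiTemp) ∈ D.GtpY)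
    (h : ∃ κ₀ : ContH1 (phi C) D.DeltaTheta (PiYdd C ⊓ ⊤), κ₀ ^ 2 = 1 ∧
      ContH1.conj (phi C) D.DeltaTheta ε
          (ContH1.coeffChange (phi C) (D.lDeltaTheta_le l) (PiYdd C ⊓ ⊤) (rootLiftClass C)) =
        ContH1.coeffChange (phi C) (D.lDeltaTheta_le l) (PiYdd C ⊓ ⊤) (rootLiftClass C) * κ₀) :
    ∃ κ : ContH1 (phi C) (D.lDeltaTheta l) (PiYdd C ⊓ ⊤), κ ^ 2 = 1 ∧
      ContH1.conj (phi C) (D.lDeltaTheta l) ε (rootLiftClass C) = rootLiftClass C * κ := by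
  obtain ⟨κ₀, hκ₀, hconj⟩ := h
  obtain ⟨κ, hκ2, -, hκ⟩ := ContH1.exists_sq_eq_one_of_conj_coeffChange_eq (phi C) (D.lDeltaTheta_le l)
    (PiYdd C ⊓ ⊤) C.l_odd (pow_mem_lDeltaTheta (D := D) (l := l)) ε (conj_conj_eq_self C hS ε hε₁)
    (conj_eq_self_of_coeffChange_eq_one C ε) (rootLiftClass C) κ₀ hκ₀ hconj
  exact ⟨κ, hκ2, hκ⟩

/-- In fact ANY class `κ` with `ε·η̲̈^Θ = η̲̈^Θ·κ` then has `κ² = 1` and lifts `κ₀` (uniqueness of the twist).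
[cite: MochizukiEtTh2009, Def 2.7 p.41] -/
theorem sq_eq_one_of_conj_rootLiftClass_eq (hS : D.Sec2Hyps) (ε : Pi C) (hε₁ : (ε : D.PiTemp) ∈ D.GtpY)
    (κ₀ : ContH1 (phi C) D.DeltaTheta (PiYdd C ⊓ ⊤)) (hκ₀ : κ₀ ^ 2 = 1)
    (hconj : ContH1.conj (phi C) D.DeltaTheta ε
          (ContH1.coeffChange (phi C) (D.lDeltaTheta_le l) (PiYdd C ⊓ ⊤) (rootLiftClass C)) =
        ContH1.coeffChange (phi C) (D.lDeltaTheta_le l) (PiYdd C ⊓ ⊤) (rootLiftClass C) * κ₀)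
    (κ : ContH1 (phi C) (D.lDeltaTheta l) (PiYdd C ⊓ ⊤))
    (hκ : ContH1.conj (phi C) (D.lDeltaTheta l) ε (rootLiftClass C) = rootLiftClass C * κ) :
    κ ^ 2 = 1 ∧ ContH1.coeffChange (phi C) (D.lDeltaTheta_le l) (PiYdd C ⊓ ⊤) κ = κ₀ :=
  ContH1.sq_eq_one_of_conj_eq_mul (phi C) (D.lDeltaTheta_le l) (PiYdd C ⊓ ⊤) C.l_odd
    (pow_mem_lDeltaTheta (D := D) (l := l)) ε (conj_conj_eq_self C hS ε hε₁)
    (conj_eq_self_of_coeffChange_eq_one C ε) (rootLiftClass C) κ₀ hκ₀ hconj κ hκ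

/-- **`hsign` from [EtTh] Prop. 1.4 (ii) at the class level** ("`Θ̈(−Ü) = −Θ̈(Ü)`": the non-trivial deck
transformation `ε ∈ Π^tp_Y ∖ Π^tp_Ÿ` of `Ÿ → Y` moves `η̈^Θ ∈ H¹(Π^tp_Ÿ, Δ_Θ)` by a class `κ₁` with `κ₁² = 1` — the
form (P14ii-cl), a HYPOTHESIS here): then `ε·η̲̈^Θ = η̲̈^Θ·κ` with `κ² = 1` in `H¹(Π_Ÿ(Π), l·Δ_Θ)`, i.e. binder `hsign`
of `prop22_ii'_model` — for `l` odd, with NO further input (no `μ_l ⊆ K`, no `l·Δ_Θ`-valued Kummer class of `−1`).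
[cite: MochizukiEtTh2009, Prop 1.4 (ii) p.20] -/
theorem hsign_of_etaDd_sign [hYN : D.GtpYdd.Normal] (hS : D.Sec2Hyps) (ε : Pi C)
    (hε₁ : (ε : D.PiTemp) ∈ D.GtpY)
    (h14 : ∃ κ₁ : ContH1 D.toTheta D.DeltaTheta D.GtpYdd, κ₁ ^ 2 = 1 ∧
      ContH1.conj D.toTheta D.DeltaTheta (ε : D.PiTemp) E.etaDd = E.etaDd * κ₁) :
    ∃ κ : ContH1 (phi C) (D.lDeltaTheta l) (PiYdd C ⊓ ⊤), κ ^ 2 = 1 ∧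
      ContH1.conj (phi C) (D.lDeltaTheta l) ε (rootLiftClass C) = rootLiftClass C * κ := by
  obtain ⟨κ₁, hκ₁, hconj⟩ := h14
  refine hsign_of_coeffChange_sign C hS ε hε₁
    ⟨ContH1.comap D.toTheta D.DeltaTheta C.Huu.subtype continuous_subtype_val
      (map_subtype_piYdd_inf_le_GtpYdd C ⊤) κ₁, ?_, ?_⟩
  · rw [← map_pow, hκ₁, map_one]
  · rw [conj_coeffChange_rootLiftClass, hconj, map_mul, coeffChange_rootLiftClass_eq_comap]

/-! ### (R3) `hfree` from the `Δ_Θ`-level non-torsion of the translates -/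

/-- Torsion of `(γᵏ·η̲̈^Θ)·(η̲̈^Θ)⁻¹` in `H¹(Π_Ÿ(Π), l·Δ_Θ)` is EQUIVALENT to torsion of the pull-back of
`(γᵏ·η̈^Θ)·(η̈^Θ)⁻¹ ∈ H¹(Π^tp_Ÿ, Δ_Θ)` (torsion is reflected by the change of coefficients, whose kernel is
`l`-torsion: abc-iut-w4-d014 `isOfFinOrder_coeffChange_iff`). [cite: MochizukiEtTh2009, Def 2.7 p.41] -/
theorem isOfFinOrder_translate_iff [hYN : D.GtpYdd.Normal] (γ : Pi C) (k : ℤ) :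
    IsOfFinOrder (ContH1.conj (phi C) (D.lDeltaTheta l) (γ ^ k) (rootLiftClass C) * (rootLiftClass C)⁻¹) ↔
      IsOfFinOrder (ContH1.comap D.toTheta D.DeltaTheta C.Huu.subtype continuous_subtype_val
        (map_subtype_piYdd_inf_le_GtpYdd C ⊤)
        (ContH1.conj D.toTheta D.DeltaTheta ((γ : D.PiTemp) ^ k) E.etaDd * E.etaDd⁻¹)) := by
  rw [← ContH1.isOfFinOrder_coeffChange_iff (phi C) (D.lDeltaTheta_le l) (PiYdd C ⊓ ⊤)
    (Nat.pos_of_ne_zero C.l_ne_zero) (pow_mem_lDeltaTheta (D := D) (l := l)), map_mul, map_inv,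
    ← ContH1.conj_coeffChange, conj_zpow_coeffChange_rootLiftClass, coeffChange_rootLiftClass_eq_comap,
    map_mul, map_inv]

/-- **Non-torsion of the translates from the `Δ_Θ` level**: if the pull-back to `Π_Ÿ(Π)` of
`(γᵏ·η̈^Θ)·(η̈^Θ)⁻¹` is not torsion (for `γ ∈ Π^tp_X̲̲`, `k ≠ 0`: [EtTh] Prop. 1.4 (i)/(iii) at the class level — the
Kummer class of a non-constant function, (P14iii-cl); a HYPOTHESIS here), then `(γᵏ·η̲̈^Θ)·(η̲̈^Θ)⁻¹` is not torsion —
the input of abc-iut-w4-d010's `hfree_of_translate_not_isOfFinOrder`. [cite: MochizukiEtTh2009, Prop 1.4 (iii) p.21] -/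
theorem not_isOfFinOrder_translate_of_etaDd [hYN : D.GtpYdd.Normal] (γ : Pi C)
    (h14 : ∀ k : ℤ, k ≠ 0 → ¬ IsOfFinOrder
      (ContH1.comap D.toTheta D.DeltaTheta C.Huu.subtype continuous_subtype_val
        (map_subtype_piYdd_inf_le_GtpYdd C ⊤)
        (ContH1.conj D.toTheta D.DeltaTheta ((γ : D.PiTemp) ^ k) E.etaDd * E.etaDd⁻¹)))
    (k : ℤ) (hk : k ≠ 0) :
    ¬ IsOfFinOrder (ContH1.conj (phi C) (D.lDeltaTheta l) (γ ^ k) (rootLiftClass C) * (rootLiftClass C)⁻¹) := by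
  rw [isOfFinOrder_translate_iff]
  exact h14 k hk

/-- **`hfree` of `prop22_ii'_model` from the `Δ_Θ` level** (its exact (R3) shape, through `h1Top`): distinct
`γ`-translates of `η̲̈^Θ` differ by non-torsion classes, GIVEN the `Δ_Θ`-level non-torsion of the pulled-back
translates of `η̈^Θ`. PROOF: `γᵐ·η̲̈·(γⁿ·η̲̈)⁻¹ = γⁿ·((γᵐ⁻ⁿ·η̲̈)·η̲̈⁻¹)`, and `h1Top`, conjugation and the change of
coefficients preserve / reflect torsion. [cite: MochizukiEtTh2009, Prop 1.4 (iii) p.21] -/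
theorem hfree_of_etaDd_free [hYN : D.GtpYdd.Normal] (γ : Pi C)
    (h14 : ∀ k : ℤ, k ≠ 0 → ¬ IsOfFinOrder
      (ContH1.comap D.toTheta D.DeltaTheta C.Huu.subtype continuous_subtype_val
        (map_subtype_piYdd_inf_le_GtpYdd C ⊤)
        (ContH1.conj D.toTheta D.DeltaTheta ((γ : D.PiTemp) ^ k) E.etaDd * E.etaDd⁻¹)))
    (m n : ℤ) (hmn : IsOfFinAddOrder
      ((h1Top C).symm (Additive.ofMul (ContH1.conj (phi C) (D.lDeltaTheta l) (γ ^ m) (rootLiftClass C))) -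
        (h1Top C).symm (Additive.ofMul (ContH1.conj (phi C) (D.lDeltaTheta l) (γ ^ n) (rootLiftClass C))))) :
    m = n := by
  by_contra hne
  apply not_isOfFinOrder_translate_of_etaDd C γ h14 (m - n) (sub_ne_zero.mpr hne)
  rw [← map_sub, ← ofMul_div, div_eq_mul_inv] at hmn
  have h1 : IsOfFinOrder (ContH1.conj (phi C) (D.lDeltaTheta l) (γ ^ m) (rootLiftClass C) *
      (ContH1.conj (phi C) (D.lDeltaTheta l) (γ ^ n) (rootLiftClass C))⁻¹) := by
    have h := ((h1Top C).toAddMonoidHom).isOfFinAddOrder hmn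
    rw [AddEquiv.coe_toAddMonoidHom, AddEquiv.apply_symm_apply] at h
    exact (isOfFinAddOrder_ofMul_iff).mp h
  have h2 : ContH1.conj (phi C) (D.lDeltaTheta l) (γ ^ m) (rootLiftClass C) *
        (ContH1.conj (phi C) (D.lDeltaTheta l) (γ ^ n) (rootLiftClass C))⁻¹ =
      ContH1.conj (phi C) (D.lDeltaTheta l) (γ ^ n)
        (ContH1.conj (phi C) (D.lDeltaTheta l) (γ ^ (m - n)) (rootLiftClass C) * (rootLiftClass C)⁻¹) := by
    rw [map_mul, map_inv, ← ContH1.conj_mul_apply, ← zpow_add, add_sub_cancel]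
  rw [h2] at h1
  have h3 := (ContH1.conj (phi C) (D.lDeltaTheta l) (γ ^ n)⁻¹).isOfFinOrder h1
  rwa [ContH1.conj_inv_conj_apply] at h3

end EtaleThetaDataOfSetting

end

end Literature.IUT.HodgeArakelov
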